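/-
Copyright (c) 2026 the pub-hodgecm-mathlib formalisation cell (harness21).  Dealer seat hodgecm-mathlib-LH4-plan (g10), req618 STAGE 1a «(D-RAM) FOUR-FRAME» squad
(director s1808∕s1809∕s1812; LEAD T17-27 DIRECTIVE b9ecbbedecc9c5ae + v1.2 a4e6366df6528969 (D2′)(R-5)–(R-11)): the SUMMIT-SIDE sorry-free DEFS LEAF №3 «PIECES∕SLICES»
of the line `Cruxes/H413/Lines/F0_P3c_DyRamFourFrame.lean` — the vocabulary its six registered tier-0 stubs are typed over (dealer WORD #8).  2026-09-03.
-/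
import Literature.NumberTheory.Rogawski1990.LocalTransferIdentityCoreDyadicDescent        -- (leaf import) the organ's vocabulary
import Literature.NumberTheory.Rogawski1990.ShalikaGermExpansionUnitaryThreeNonsplitCM     -- (leaf import) `ShalikaGermExpansionNonsplit`
import Literature.NumberTheory.Rogawski1990.LocalTransferAtOneOfShalikaRankUnramifiedAll   -- (leaf import) ★ `cmLocalIntegralLevel`, `localNonsplitEquiv`
import Literature.NumberTheory.Rogawski1990.LocalTransferAtOneOfPopulations                -- ★ `localTransferAtOne_of_populations` (row shapes)
import Literature.NumberTheory.Automorphic.LocalUnitaryGroupCongr                          -- (leaf import) ★ `unitaryGroupCongr`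
import Literature.NumberTheory.Automorphic.UnitaryThreeFourFrameDefs                       -- ★ #0a `IsVertexLattice`, `latt`, `mapGL`, `pairing`, `StdForm.antidiagonal`
import HarnessLib

/-!
# F0 · P3c · line LH4 «(D-RAM) FOUR-FRAME» — DEFS LEAF №3 «PIECES∕SLICES» (v3): the explicit reference pieces `gselStar = (1_K, f_{T+}, f_{T−}, f_reg)`, the level of record
`mstarFn`, and the three TIER-0 SLICES `PiecePropsWild ∕ RankTableWild ∕ PieceRowsWild` of `AnchorRowsWild` (F0P3a-p01 (g30) law socket v1.5 §6 VERBATIM)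

Cell `pub/hodgecm-mathlib`, crux H413 = `stmt-HodgeConjecture-24833` (helper lane `--supports stmt-HodgeConjecture-24833 --as helper`), route HCCMUnconditional;
dealer LH4-plan (g10) deal g10-№3 v3 (WORD #8∕#10 2026-09-03: v2 + REF5 R5-2∕R5-3 + F0P3a-p01 (B3) + LEAD T17-34 (b6)(b9)), filed by LH4-p03 (g11).  DEF LANE: `def`s ONLY (Props, `ℕ`-valued functions, test functions), NO theorem,
NO instance, NO notation, NO `sorry`, NO named fact, no `set_option`.

WHY (LEAD T17-29 (R-7) + T17-31 (R-8)(K-1)(R-9); T11-93): the line's SIX registered tier-0 stubs are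
`stub_rows_unit0 ∕ stub_rows_transvPlus ∕ stub_rows_transvMinus ∕ stub_rows_regular : PieceRowsWild gselStar j` (`j = 0, 1, 2, 3`), `stub_pieceProps : PiecePropsWild mstarFn gselStar`,
`stub_rankTableWild : RankTableWild gselStar`, and its sorry-free composition is ★-to-be `anchorRowsWild_of_slices` (v1.5 §6, PROVED; deal g10-#15) → ★
`rankTransferWild_of_anchorRows` (GATE 1a-1 §5; #6) → ★ `dyRamCore_of_rankTransferWild` (cert v1.1; #14 p854617) → `stub_DyRamCore`'s statement BY NAME.
Tier-1 unit modules and tier-2 prover files conclude these Props BY NAME, so the slices AND the explicit pieces live in a sorry-free tree module.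

CONTENTS.
* §1 helpers: `wMatrix` (the `w`-adic matrix of a local unitary element through ★ `localNonsplitEquiv`), `InLevel ϖ m X` (`X ∈ ϖ^m M₃(𝒪_w)`), `NearTransvShell ϖ ℓ m X`
  (the depth window `v_E(X) = ℓ` exactly and `X² ∈ ϖ^m M₃(𝒪_w)` — REF5 R5-2 (c)∕R5-3 (B)), `valueSetMod σ ϖ m X` (the value set mod `ϖ^m` of `y ↦ ⟨y, X·y⟩_{Φ₃}` on `𝒪_w³`),
  `xPlus σ ϖ d` (the reference class-`+` transvection nilpotent `c·E₁₃` at depth `ℓ₀ = d % 2`), `LabelPlus σ ϖ d m X :⟺ valueSetMod σ ϖ m X = valueSetMod σ ϖ m (xPlus σ ϖ d)`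
  (F0P3a-p01 (g30) 20:01:07Z (B3) VALUE-SET FORM — a level-`m` class function by construction; it replaces v2's exact-equation proposal, which REF5 R5-1 (4)∕R5-2 (c) showed
  is not left-`K(ϖ^{m*})`-stable), `edgeFixCount` (type-2 tree neighbours of `𝒪_w³` fixed by `u`; U2G∕U3 edge-law currency, NOT a tier-0 selector).
* §2 the level of record: `dOfPlace L v w` (INTRINSIC: the least `n > 0` with `v_w(x − σ_w x) = ϖ_w^n` for some `x ∈ 𝒪_w` — at a ramified `σ`-stable place this set contains
  the `d` of every `IsRamifiedQuadraticDatum σ_w ϖ d t` (take `x = ϖ`), so the `sInf` is never the empty-set junk where a stub instantiates it; the identification `dOfPlace = d`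
  is the NAMED tier-1 stub `stub_U0_dOfPlace_eq` — desk inventory v1 U0 `d_t_unique`, LEAD T17-34 (b6); REF5 R5-2 (a): the set is exactly `{d + 2k}`, a two-line lemma over
  ★ `F0P3cDyRamWildPlaceDatum`), `mstarOfRecord d := d % 2 + 2d − 1` (memo (0b-i) v1.2 closed form `m* = ℓ₀ + 2d − 1`, `ℓ₀ = d mod 2`: R-U 3, R-P 6), `mstarFn L v w :=
  mstarOfRecord (dOfPlace L v w)` (the `M` of `PiecePropsWild M gselStar` ∕ `AnchorRowsWild M` ∕ `RankTransferWild M` in the composition).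
* §3 the EXPLICIT PIECES, each of the selector type of v1.5 §6 (`∀ L v w, hw → ϖ_w → (G′_v → ℂ)`): `pieceUnit0 = 1_K` (type-0 anchor; row (1) = GATE §4 at `t = 0`);
  `pieceTransvPlus = f_{T+}` and `pieceTransvMinus = f_{T−}` (the indicators of `{u ∈ K | NearTransvShell ϖ ℓ₀ m* X ∧ (¬)LabelPlus σ_w ϖ d m* X}`, `X := wMatrix u − 1`,
  `d := dOfPlace`, `ℓ₀ := d % 2`, `m* := mstarFn`); `pieceReg = f_reg` (`u ∈ K`, `X² ∉ ϖ^{m*}M₃(𝒪)`; p01 (B3) «=»);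
  `gselStar : Fin 4 → ‹selector› := (pieceUnit0, pieceTransvPlus, pieceTransvMinus, pieceReg)` — REF5 R5-3 (B) ∕ DESIGN WORD v1 §B: the unipotent orbital-integral table
  rows `(1, T₊, T₋, reg)` × these columns is LOWER TRIANGULAR with positive diagonal, so `RankTableWild gselStar` is positivity + support algebra at EVERY `d` (no census
  digit); the v2 selector `(1_K, g_E, f_T, f_reg)` is WITHDRAWN — REF5 R5-3 (A): at `d` odd the `g_E` column is `(q₂+1)`× the `1_K` column on `{1, T₊, T₋}`, so its table is
  singular for `S ∋ 1, T₋`.  `pieceEdge = g_E := 1_K · #{type-2 neighbours N of 𝒪_w³ with u·N = N}` stays as a def (B-p04∕B-p08 «=» 20:01∕20:05Z) for the U2G∕U3 edge law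
  ((K-1)(c) `e = n₀ + n₂ − 1`), outside `gselStar`.
* §4 the three slices `PiecePropsWild M gsel`, `RankTableWild gsel`, `PieceRowsWild gsel j` — `F0/P3a/F0P3a-p01/g30/LAWSOCKET-DRAM-FourFrame.v1_5.F0P3ap01g30.lean`
  481abd786a36bbea §6 l. 764–844 BYTE-EQUAL (only the enclosing namespace differs).

HONEST LABEL: HC_CM is proved only modulo the 7 printed citations (2 remaining: hLiu418 = stmt-HodgeConjecture-24832, h413 = stmt-HodgeConjecture-24833) until rung 0 closes;
this file asserts nothing (count-neutral vehicle).

## References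
* [Rogawski1990] J. D. Rogawski, *Automorphic Representations of Unitary Groups in Three Variables*, Ann. of Math. Stud. 123 (1990): Prop. 4.9.1, §4.9 pp. 55–57, §12.2.
* [LanglandsShelstad1987] R. P. Langlands, D. Shelstad, *On the definition of transfer factors*, Math. Ann. 278 (1987), §1–§3.
* [Jacobowitz1962] R. Jacobowitz, *Hermitian forms over local fields*, Amer. J. Math. 84 (1962) 441–465 (ramified dyadic hermitian lattices; the invariants `d`, `t`).
* [BruhatTits1972] F. Bruhat, J. Tits, *Groupes réductifs sur un corps local I*, Publ. Math. IHÉS 41 (1972), §10 (the tree of quasi-split `U(3)`).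
-/

noncomputable section

namespace Summit.HodgeConjecture.HodgeConjecture.Cruxes.H413.F0P3cDyRamFourFramePieces

open MeasureTheory Measure NumberField IsDedekindDomain Topology Filter
open Literature.NumberTheory.Automorphic Literature.NumberTheory.Automorphic.UnitaryGroup Literature.NumberTheory.Automorphic.IntegralReduction
open Literature.NumberTheory.Rogawski1990 Literature.NumberTheory.GaloisRepresentations
open Literature.NumberTheory.Automorphic.HermitianLattice Literature.NumberTheory.Automorphic.UnitaryThreeFourFrame
open Literature.MeasureTheory.Group (descConj)
open scoped Matrix MatrixGroups Classical ValuativeRel WithZero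

/-! ## §1  helpers -/

/-- The `w`-adic matrix of a local unitary element, read through ★ `localNonsplitEquiv` (the realisation `U(Φ₃)(L⁺_v) ≃* U(σ_w, Φ₃)(L_w)` at the `σ`-stable place `w`). -/
def wMatrix (L : Type) [Field L] [NumberField L] [IsCMField L]
    {v : HeightOneSpectrum (𝓞 ↥(maximalRealSubfield L))} (w : UnitaryGroup.PlacesOver L v)
    (hw : IsCMField.complexConj L • w.1 = w.1) (u : ((UnitaryGroup.cmDatum L 3 (Matrix.of fun i j : Fin 3 => if i.val + j.val + 1 = 3 then (1 : L) else 0)).Local v)) : Matrix (Fin 3) (Fin 3) (w.1.adicCompletion L) :=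
  (((localNonsplitEquiv (IsCMField.complexConj L) (Matrix.of fun i j : Fin 3 => if i.val + j.val + 1 = 3 then (1 : L) else 0) (IsCMField.complexConj_ne_one L) w hw u :
      ↥(unitaryGroupOfForm (galAdicCompletionMap (L := L) (IsCMField.complexConj L) hw) (placeForm (Matrix.of fun i j : Fin 3 => if i.val + j.val + 1 = 3 then (1 : L) else 0) w.1))) : GL (Fin 3) (w.1.adicCompletion L)) : Matrix (Fin 3) (Fin 3) (w.1.adicCompletion L))

/-- `InLevel ϖ m X` — every entry of `X` lies in `ϖ^m·𝒪`, i.e. `X ∈ ϖ^m·M₃(𝒪_w)` (the idiom of `AnchorRowsWild`'s left-invariance clause). -/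
def InLevel {K : Type*} [Field K] [Valued K ℤᵐ⁰] (ϖ : K) (m : ℕ) (X : Matrix (Fin 3) (Fin 3) K) : Prop :=
  ∀ a b, Valued.v ((ϖ ^ m)⁻¹ * X a b) ≤ 1

/-- `NearTransvShell ϖ ℓ m X` — the NEAR-TRANSVECTION SHELL at depth `ℓ` and level `m`: `v_E(X) = ℓ` EXACTLY (`X ∈ ϖ^ℓ M₃(𝒪) ∖ ϖ^{ℓ+1} M₃(𝒪)`) and `X² ∈ ϖ^m M₃(𝒪)`
(REF5 R5-2 (c)∕R5-3 (B)(C): the explicit depth window keeps the label level-stable — `m* − ℓ₀ = 2d − 1` — and keeps fused∕deeper transvections and the identity out). -/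
def NearTransvShell {K : Type*} [Field K] [Valued K ℤᵐ⁰] (ϖ : K) (ℓ m : ℕ) (X : Matrix (Fin 3) (Fin 3) K) : Prop :=
  InLevel ϖ ℓ X ∧ ¬ InLevel ϖ (ℓ + 1) X ∧ InLevel ϖ m (X * X)

/-- `valueSetMod σ ϖ m X` — the VALUE SET MOD `ϖ^m` of the pairing `y ↦ ⟨y, X·y⟩_{Φ₃}` on integral vectors, as a subset of `K` (the values thickened by `ϖ^m·𝒪_w`).
F0P3a-p01 (g30) 20:01:07Z (B3): the transvection label is a property of this set (memo (0b-iii) v1.2 §4); it depends on `X` only modulo `ϖ^m·M₃(𝒪_w)` and is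
`Ad K`-invariant (a unitary integral `k` permutes `𝒪_w³` by `Φ₃`-isometries), so labels read from it are level-`m` class functions BY CONSTRUCTION. -/
def valueSetMod {K : Type*} [Field K] [Valued K ℤᵐ⁰] (σ : K →+* K) (ϖ : K) (m : ℕ) (X : Matrix (Fin 3) (Fin 3) K) : Set K :=
  {z | ∃ y : Fin 3 → K, (∀ a, Valued.v (y a) ≤ 1) ∧
    Valued.v ((ϖ ^ m)⁻¹ * (z - UnitaryLatticeTree.pairing σ ((StdForm.antidiagonal 3).over K) y (X.mulVec y))) ≤ 1}

/-- `xPlus σ ϖ d` — the REFERENCE TRANSVECTION NILPOTENT OF CLASS `+` AT DEPTH `ℓ₀ = d % 2`: `X₊ = c·E₁₃` (`1 + X₊ : y ↦ y + c·⟨e₁, y⟩_{Φ₃}·e₁`, the unitary transvection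
along the isotropic line `e₁`), `c := (ϖ − σϖ)·(ϖ·σϖ)^{−(d − ℓ₀)∕2}` — skew (`σc = −c`), of `E`-valuation `d − (d − ℓ₀) = ℓ₀` when `v_E(ϖ − σϖ) = ϖ^d`, and of norm class
`+` (`c∕(ϖ − σϖ) ∈ N(E^×)`).  Its value set is `c·N(𝒪_w)`. -/
def xPlus {K : Type*} [Field K] (σ : K →+* K) (ϖ : K) (d : ℕ) : Matrix (Fin 3) (Fin 3) K :=
  Matrix.of fun i j => if i = 0 ∧ j = 2 then (ϖ - σ ϖ) * ((ϖ * σ ϖ) ^ ((d - d % 2) / 2))⁻¹ else 0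

/-- `LabelPlus σ ϖ d m X` — the TRANSVECTION LABEL `+` AT LEVEL `m` (F0P3a-p01 (g30) (B3) value-set form; memo (0b-iii) v1.2 §4 `L = T₊`): the value set mod `ϖ^m` of `X`
equals that of the reference class-`+` nilpotent `xPlus σ ϖ d` of depth `ℓ₀ = d % 2`.  On the shell `NearTransvShell ϖ ℓ₀ m* X` (`m* − ℓ₀ = 2d − 1 = ` the precision at
which the two norm classes of `c∕(ϖ − σϖ)` separate, conductor `d`) it distinguishes the two transvection classes (REF5 R5-3 (C)).  Replaces v2's exact-equation
proposal (REF5 R5-1 (4)∕R5-2 (c): not left-`K(ϖ^{m*})`-stable). -/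
def LabelPlus {K : Type*} [Field K] [Valued K ℤᵐ⁰] (σ : K →+* K) (ϖ : K) (d m : ℕ) (X : Matrix (Fin 3) (Fin 3) K) : Prop :=
  valueSetMod σ ϖ m X = valueSetMod σ ϖ m (xPlus σ ϖ d)

/-- `edgeFixCount σ ϖ T` — the number of TYPE-2 TREE NEIGHBOURS of the root `𝒪³` (type-2 vertex lattices `N ≤ 𝒪³`; ★ `latticeGraph` adjacency = strict containment)
FIXED by `T ∈ GL₃` (cf. ★ #0a `fixedVertexCount`, which counts all fixed type-`t` vertices; B-p08 20:05:52Z: «type 2 ∧ `N ≤ latt 1`» IS «type-2 neighbour of the root»,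
a finite set, so `ncard` is an honest count).  The edge piece's currency ((K-1)(c) fixed edges `e = n₀ + n₂ − 1`); B-p04∕B-p08 «=». -/
def edgeFixCount {K : Type*} [Field K] [Valued K ℤᵐ⁰] (σ : K →+* K) (ϖ : K) (T : GL (Fin 3) K) : ℕ :=
  {N : Submodule (Valued.integer K) (Fin 3 → K) | UnitaryLatticeTree.IsVertexLattice σ ϖ ((StdForm.antidiagonal 3).over K) 2 N ∧
      N ≤ UnitaryLatticeTree.latt (1 : Matrix (Fin 3) (Fin 3) K) ∧ UnitaryLatticeTree.mapGL T N = N}.ncard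

/-! ## §2  the level of record -/

/-- **`dOfPlace L v w`** — the INTRINSIC `d` of the place: the least `n > 0` such that `v_w(x − σ_w x) = ϖ_w^n` (as a valuation: `exp(−n)`) for some `x ∈ 𝒪_w`; `0` off the
`σ`-stable locus.  For every `IsRamifiedQuadraticDatum σ_w ϖ d t` the set contains `d` (`x = ϖ`: `v(ϖ − σϖ) = vϖ^d`), so at a ramified `σ`-stable place the `sInf` is a
genuine minimum (never the empty-set junk of R4-71 (T1)); REF5 R5-2 (a): with `𝒪_w = 𝒪_v[ϖ]`, `x = a + bϖ ↦ x − σx = b(ϖ − σϖ)`, the set is exactly `{d + 2k}`.  That it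
EQUALS the datum's `d` — `IsRamifiedQuadraticDatum σ_w ϖ d t → dOfPlace L v w = d` — is the NAMED tier-1 stub `stub_U0_dOfPlace_eq` (desk inventory v1 U0 `d_t_unique`;
LEAD T17-34 (b6): the condition under which the intrinsic `sInf` is accepted), over ★ `F0P3cDyRamWildPlaceDatum` (#12). -/
def dOfPlace (L : Type) [Field L] [NumberField L] [IsCMField L]
    (v : HeightOneSpectrum (𝓞 ↥(maximalRealSubfield L))) (w : UnitaryGroup.PlacesOver L v) : ℕ :=
  if hw : IsCMField.complexConj L • w.1 = w.1 then
    sInf {n : ℕ | 0 < n ∧ ∃ x : (w.1.adicCompletion L), Valued.v x ≤ 1 ∧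
      Valued.v (x - (galAdicCompletionMap (L := L) (IsCMField.complexConj L) hw) x) = WithZero.exp (-(n : ℤ))}
  else 0

/-- **`mstarOfRecord d = d % 2 + 2·d − 1`** — the LEVEL OF RECORD `m* = ℓ₀ + 2d − 1`, `ℓ₀ = d mod 2` (memo (0b-i) v1.2 CLOSED FORM: R-U `d = 2 ↦ 3`, R-P `d = 3 ↦ 6`; tame
`d = 1 ↦ 2`): the `ϖ_w`-adic congruence level at which the reference pieces are left-invariant and at which the census separates the unipotent classes.  ONLY EVER
USED UNDER `1 ≤ d` (every instantiation sits behind `_he` at a ramified place, where `dOfPlace ≥ 1`); the `ℕ`-truncation `mstarOfRecord 0 = 0` is junk BY DESIGN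
(LEAD T17-34 (b6)). -/
def mstarOfRecord (d : ℕ) : ℕ := d % 2 + 2 * d - 1

/-- **`mstarFn L v w := mstarOfRecord (dOfPlace L v w)`** — the level schedule `M` at which the line instantiates `PiecePropsWild M gselStar`, `AnchorRowsWild M` and
`RankTransferWild M` (the profile pieces `f_{T±}`, `f_reg` read the same number, so no cross-uniformiser identification appears in any statement). -/
def mstarFn (L : Type) [Field L] [NumberField L] [IsCMField L]
    (v : HeightOneSpectrum (𝓞 ↥(maximalRealSubfield L))) (w : UnitaryGroup.PlacesOver L v) : ℕ :=
  mstarOfRecord (dOfPlace L v w)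

/-! ## §3  the explicit pieces and `gselStar` -/

/-- **`pieceUnit0 = 1_K`** — the indicator of the integral level `K = cmLocalIntegralLevel` (the type-0 ANCHOR; its type-(1) row is GATE 1a-1 §4 at `t = 0`). -/
def pieceUnit0 (L : Type) [Field L] [NumberField L] [IsCMField L]
    (v : HeightOneSpectrum (𝓞 ↥(maximalRealSubfield L))) (w : UnitaryGroup.PlacesOver L v)
    (_hw : IsCMField.complexConj L • w.1 = w.1) (_ϖ : (w.1.adicCompletion L)) : ((UnitaryGroup.cmDatum L 3 (Matrix.of fun i j : Fin 3 => if i.val + j.val + 1 = 3 then (1 : L) else 0)).Local v) → ℂ :=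
  Set.indicator (cmLocalIntegralLevel L 3 (Matrix.of fun i j : Fin 3 => if i.val + j.val + 1 = 3 then (1 : L) else 0) v : Set ((UnitaryGroup.cmDatum L 3 (Matrix.of fun i j : Fin 3 => if i.val + j.val + 1 = 3 then (1 : L) else 0)).Local v)) (fun _ => (1 : ℂ))

/-- **`pieceEdge = g_E`** — the EDGE PIECE (LEAD T17-31 (K-1)): `g_E(u) = 1_K(u) · #{type-2 neighbours N of 𝒪_w³ with ι_w(u)·N = N}` = `Σ_{N ∼ 𝒪³, type 2} 1_{K ∩ Stab N}(u)`
(K-supported, `Ad K`-invariant, left `K(ϖ^M)`-invariant for `M ≥ 1`; B-p04 20:01:01Z ∕ B-p08 20:05:52Z «=»: its orbital integral counts FIXED EDGES at the root).  NOT A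
TIER-0 SELECTOR (REF5 R5-3 (A): at `d` odd every `K`-transvection lies in `K(ϖ)`, which fixes every type-2 neighbour, so the `g_E` column is `(q₂+1)`× the `1_K` column
on `{1, T₊, T₋}` and the table is singular for `S ∋ 1, T₋`); kept for the U2G∕U3 edge law ((K-1)(c) `e = n₀ + n₂ − 1`). -/
def pieceEdge (L : Type) [Field L] [NumberField L] [IsCMField L]
    (v : HeightOneSpectrum (𝓞 ↥(maximalRealSubfield L))) (w : UnitaryGroup.PlacesOver L v)
    (hw : IsCMField.complexConj L • w.1 = w.1) (ϖ : (w.1.adicCompletion L)) : ((UnitaryGroup.cmDatum L 3 (Matrix.of fun i j : Fin 3 => if i.val + j.val + 1 = 3 then (1 : L) else 0)).Local v) → ℂ :=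
  fun u => Set.indicator (cmLocalIntegralLevel L 3 (Matrix.of fun i j : Fin 3 => if i.val + j.val + 1 = 3 then (1 : L) else 0) v : Set ((UnitaryGroup.cmDatum L 3 (Matrix.of fun i j : Fin 3 => if i.val + j.val + 1 = 3 then (1 : L) else 0)).Local v))
    (fun u => (edgeFixCount (galAdicCompletionMap (L := L) (IsCMField.complexConj L) hw) ϖ ((localNonsplitEquiv (IsCMField.complexConj L) (Matrix.of fun i j : Fin 3 => if i.val + j.val + 1 = 3 then (1 : L) else 0) (IsCMField.complexConj_ne_one L) w hw u :
      ↥(unitaryGroupOfForm (galAdicCompletionMap (L := L) (IsCMField.complexConj L) hw) (placeForm (Matrix.of fun i j : Fin 3 => if i.val + j.val + 1 = 3 then (1 : L) else 0) w.1))) : GL (Fin 3) (w.1.adicCompletion L)) : ℂ)) u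

/-- **`pieceTransvPlus = f_{T+}`** — the CLASS-`+` NEAR-TRANSVECTION PIECE at depth `ℓ₀ = dOfPlace % 2` and level `m* = mstarFn`: the indicator of
`{u ∈ K | NearTransvShell ϖ ℓ₀ m* X ∧ LabelPlus σ_w ϖ d m* X}`, `X := wMatrix u − 1` (memo (0b-iii) v1.2 §4 anchor `T₊`; p01 (B3) label; REF5 R5-2 (c)∕R5-3 (B) window).
Vanishes at `1` and on class-`−` transvections of depth `ℓ₀`; positive on its own orbit ∩ `K`. -/
def pieceTransvPlus (L : Type) [Field L] [NumberField L] [IsCMField L]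
    (v : HeightOneSpectrum (𝓞 ↥(maximalRealSubfield L))) (w : UnitaryGroup.PlacesOver L v)
    (hw : IsCMField.complexConj L • w.1 = w.1) (ϖ : (w.1.adicCompletion L)) : ((UnitaryGroup.cmDatum L 3 (Matrix.of fun i j : Fin 3 => if i.val + j.val + 1 = 3 then (1 : L) else 0)).Local v) → ℂ :=
  Set.indicator {u : ((UnitaryGroup.cmDatum L 3 (Matrix.of fun i j : Fin 3 => if i.val + j.val + 1 = 3 then (1 : L) else 0)).Local v) | u ∈ cmLocalIntegralLevel L 3 (Matrix.of fun i j : Fin 3 => if i.val + j.val + 1 = 3 then (1 : L) else 0) v ∧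
      NearTransvShell ϖ (dOfPlace L v w % 2) (mstarFn L v w) (wMatrix L w hw u - 1) ∧
      LabelPlus (galAdicCompletionMap (L := L) (IsCMField.complexConj L) hw) ϖ (dOfPlace L v w) (mstarFn L v w) (wMatrix L w hw u - 1)} (fun _ => (1 : ℂ))

/-- **`pieceTransvMinus = f_{T−}`** — the CLASS-`−` NEAR-TRANSVECTION PIECE: same shell, label NEGATED (on the shell `¬LabelPlus` = the other norm class, REF5 R5-3 (C);
no non-canonical non-norm unit is named).  Vanishes at `1` and on class-`+` transvections of depth `ℓ₀`; positive on its own orbit ∩ `K` (REF5 R5-3 (B): depth-`ℓ₀`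
transvections of both classes exist in `K` at either parity, `ℓ₀ ≡ d (2)`). -/
def pieceTransvMinus (L : Type) [Field L] [NumberField L] [IsCMField L]
    (v : HeightOneSpectrum (𝓞 ↥(maximalRealSubfield L))) (w : UnitaryGroup.PlacesOver L v)
    (hw : IsCMField.complexConj L • w.1 = w.1) (ϖ : (w.1.adicCompletion L)) : ((UnitaryGroup.cmDatum L 3 (Matrix.of fun i j : Fin 3 => if i.val + j.val + 1 = 3 then (1 : L) else 0)).Local v) → ℂ :=
  Set.indicator {u : ((UnitaryGroup.cmDatum L 3 (Matrix.of fun i j : Fin 3 => if i.val + j.val + 1 = 3 then (1 : L) else 0)).Local v) | u ∈ cmLocalIntegralLevel L 3 (Matrix.of fun i j : Fin 3 => if i.val + j.val + 1 = 3 then (1 : L) else 0) v ∧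
      NearTransvShell ϖ (dOfPlace L v w % 2) (mstarFn L v w) (wMatrix L w hw u - 1) ∧
      ¬ LabelPlus (galAdicCompletionMap (L := L) (IsCMField.complexConj L) hw) ϖ (dOfPlace L v w) (mstarFn L v w) (wMatrix L w hw u - 1)} (fun _ => (1 : ℂ))

/-- **`pieceReg = f_reg`** — the REGULAR-PROFILE piece (F0P3a-p01 (B3) «=») at level `m* = mstarFn L v w`: the indicator of `{u ∈ K | X² ∉ ϖ^{m*}M₃(𝒪)}`, `X := wMatrix u − 1`
(memo (0b-iii) v1.2 §4.2 (ii), the regular-like profiles `b < m`). -/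
def pieceReg (L : Type) [Field L] [NumberField L] [IsCMField L]
    (v : HeightOneSpectrum (𝓞 ↥(maximalRealSubfield L))) (w : UnitaryGroup.PlacesOver L v)
    (hw : IsCMField.complexConj L • w.1 = w.1) (ϖ : (w.1.adicCompletion L)) : ((UnitaryGroup.cmDatum L 3 (Matrix.of fun i j : Fin 3 => if i.val + j.val + 1 = 3 then (1 : L) else 0)).Local v) → ℂ :=
  Set.indicator {u : ((UnitaryGroup.cmDatum L 3 (Matrix.of fun i j : Fin 3 => if i.val + j.val + 1 = 3 then (1 : L) else 0)).Local v) | u ∈ cmLocalIntegralLevel L 3 (Matrix.of fun i j : Fin 3 => if i.val + j.val + 1 = 3 then (1 : L) else 0) v ∧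
      ¬ InLevel ϖ (mstarFn L v w) ((wMatrix L w hw u - 1) * (wMatrix L w hw u - 1))} (fun _ => (1 : ℂ))

/-- **`gselStar = (1_K, f_{T+}, f_{T−}, f_reg)`** — THE EXPLICIT PIECE SELECTOR of the line (v3: REF5 R5-3 (B) ∕ DESIGN WORD v1 §B symmetric family — the unipotent
table is lower triangular with positive diagonal at every `d`), of the selector type of v1.5 §6; the six tier-0 stubs are `PieceRowsWild gselStar j` (`j : Fin 4`),
`PiecePropsWild mstarFn gselStar`, `RankTableWild gselStar`. -/
def gselStar : Fin 4 → (∀ (L : Type) [Field L] [NumberField L] [IsCMField L] (v : HeightOneSpectrum (𝓞 ↥(maximalRealSubfield L))) (w : UnitaryGroup.PlacesOver L v), IsCMField.complexConj L • w.1 = w.1 → w.1.adicCompletion L → ((UnitaryGroup.cmDatum L 3 (Matrix.of fun i j : Fin 3 => if i.val + j.val + 1 = 3 then (1 : L) else 0)).Local v) → ℂ) :=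
  ![pieceUnit0, pieceTransvPlus, pieceTransvMinus, pieceReg]

/-! ## §4  the three tier-0 slices of `AnchorRowsWild` — law socket v1.5 §6 (F0P3a-p01 (g30)) VERBATIM -/

/-- U4-a · `PiecePropsWild M gsel`: every explicit piece is smooth, supported in the integral level `K`, `Ad K`-invariant and left-invariant under the `ϖ_w`-adic level-`M(w)`
congruence set, at every wild place (for every uniformiser binder). -/
def PiecePropsWild (M : ∀ (L : Type) [Field L] [NumberField L] [IsCMField L] (v : HeightOneSpectrum (𝓞 ↥(maximalRealSubfield L))), UnitaryGroup.PlacesOver L v → ℕ) {n : ℕ} (gsel : Fin n → (∀ (L : Type) [Field L] [NumberField L] [IsCMField L] (v : HeightOneSpectrum (𝓞 ↥(maximalRealSubfield L))) (w : UnitaryGroup.PlacesOver L v), IsCMField.complexConj L • w.1 = w.1 → w.1.adicCompletion L → ((UnitaryGroup.cmDatum L 3 (Matrix.of fun i j : Fin 3 => if i.val + j.val + 1 = 3 then (1 : L) else 0)).Local v) → ℂ)) : Prop :=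
    ∀ (L : Type) [Field L] [NumberField L] [IsCMField L]
      {v : HeightOneSpectrum (𝓞 ↥(maximalRealSubfield L))} (w : UnitaryGroup.PlacesOver L v)
      (hw : IsCMField.complexConj L • w.1 = w.1) (_he : v.asIdeal.ramificationIdx' w.1.asIdeal ≠ 1)
      (_h2 : ¬ IsUnit (2 : 𝒪[w.1.adicCompletion L]))
      (ϖ : (w.1.adicCompletion L)) (_hϖ : Valued.v ϖ = WithZero.exp (-1 : ℤ))
      [MeasurableSpace ((UnitaryGroup.cmDatum L 3 (Matrix.of fun i j : Fin 3 => if i.val + j.val + 1 = 3 then (1 : L) else 0)).Local v)] [BorelSpace ((UnitaryGroup.cmDatum L 3 (Matrix.of fun i j : Fin 3 => if i.val + j.val + 1 = 3 then (1 : L) else 0)).Local v)]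
      [∀ γ : ((UnitaryGroup.cmDatum L 3 (Matrix.of fun i j : Fin 3 => if i.val + j.val + 1 = 3 then (1 : L) else 0)).Local v), MeasurableSpace (((UnitaryGroup.cmDatum L 3 (Matrix.of fun i j : Fin 3 => if i.val + j.val + 1 = 3 then (1 : L) else 0)).Local v) ⧸ Subgroup.centralizer ({γ} : Set ((UnitaryGroup.cmDatum L 3 (Matrix.of fun i j : Fin 3 => if i.val + j.val + 1 = 3 then (1 : L) else 0)).Local v)))]
      [∀ γ : ((UnitaryGroup.cmDatum L 3 (Matrix.of fun i j : Fin 3 => if i.val + j.val + 1 = 3 then (1 : L) else 0)).Local v), BorelSpace (((UnitaryGroup.cmDatum L 3 (Matrix.of fun i j : Fin 3 => if i.val + j.val + 1 = 3 then (1 : L) else 0)).Local v) ⧸ Subgroup.centralizer ({γ} : Set ((UnitaryGroup.cmDatum L 3 (Matrix.of fun i j : Fin 3 => if i.val + j.val + 1 = 3 then (1 : L) else 0)).Local v)))]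
      (j : Fin n),
        IsLocSmooth ((gsel j) L v w hw ϖ) ∧
        tsupport ((gsel j) L v w hw ϖ) ⊆ (cmLocalIntegralLevel L 3 (Matrix.of fun i j : Fin 3 => if i.val + j.val + 1 = 3 then (1 : L) else 0) v : Set ((UnitaryGroup.cmDatum L 3 (Matrix.of fun i j : Fin 3 => if i.val + j.val + 1 = 3 then (1 : L) else 0)).Local v)) ∧
        (∀ u ∈ cmLocalIntegralLevel L 3 (Matrix.of fun i j : Fin 3 => if i.val + j.val + 1 = 3 then (1 : L) else 0) v, ∀ x, (gsel j) L v w hw ϖ (u * x * u⁻¹) = (gsel j) L v w hw ϖ x) ∧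
        (∀ u : ((UnitaryGroup.cmDatum L 3 (Matrix.of fun i j : Fin 3 => if i.val + j.val + 1 = 3 then (1 : L) else 0)).Local v),
          (∀ a b, Valued.v ((ϖ ^ (M L v w))⁻¹ *
            (((((localNonsplitEquiv (IsCMField.complexConj L) (Matrix.of fun i j : Fin 3 => if i.val + j.val + 1 = 3 then (1 : L) else 0) (IsCMField.complexConj_ne_one L) w hw u :
              ↥(unitaryGroupOfForm (galAdicCompletionMap (L := L) (IsCMField.complexConj L) hw) (placeForm (Matrix.of fun i j : Fin 3 => if i.val + j.val + 1 = 3 then (1 : L) else 0) w.1))) : GL (Fin 3) (w.1.adicCompletion L)) : Matrix (Fin 3) (Fin 3) (w.1.adicCompletion L))) a b - (1 : Matrix (Fin 3) (Fin 3) (w.1.adicCompletion L)) a b)) ≤ 1) →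
          ∀ x, (gsel j) L v w hw ϖ (u * x) = (gsel j) L v w hw ϖ x)

/-- U4-b · `RankTableWild M gsel` — THE RANK LAYER ON EXPLICIT PIECES ((iv-a); memo (0b-i), no law in v2): for every admissible unipotent datum `(S, mU)` (conjuncts (i)–(iii)
of ★ `ShalikaGermExpansionNonsplit`) there is an INJECTIVE labelling `e : ↥S → Fin n` of the unipotent classes by explicit pieces whose orbital-integral table is invertible. -/
def RankTableWild {n : ℕ} (gsel : Fin n → (∀ (L : Type) [Field L] [NumberField L] [IsCMField L] (v : HeightOneSpectrum (𝓞 ↥(maximalRealSubfield L))) (w : UnitaryGroup.PlacesOver L v), IsCMField.complexConj L • w.1 = w.1 → w.1.adicCompletion L → ((UnitaryGroup.cmDatum L 3 (Matrix.of fun i j : Fin 3 => if i.val + j.val + 1 = 3 then (1 : L) else 0)).Local v) → ℂ)) : Prop :=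
    ∀ (L : Type) [Field L] [NumberField L] [IsCMField L]
      {v : HeightOneSpectrum (𝓞 ↥(maximalRealSubfield L))} (w : UnitaryGroup.PlacesOver L v)
      (hw : IsCMField.complexConj L • w.1 = w.1) (_he : v.asIdeal.ramificationIdx' w.1.asIdeal ≠ 1)
      (_h2 : ¬ IsUnit (2 : 𝒪[w.1.adicCompletion L]))
      (ϖ : (w.1.adicCompletion L)) (_hϖ : Valued.v ϖ = WithZero.exp (-1 : ℤ))
      [MeasurableSpace ((UnitaryGroup.cmDatum L 3 (Matrix.of fun i j : Fin 3 => if i.val + j.val + 1 = 3 then (1 : L) else 0)).Local v)] [BorelSpace ((UnitaryGroup.cmDatum L 3 (Matrix.of fun i j : Fin 3 => if i.val + j.val + 1 = 3 then (1 : L) else 0)).Local v)]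
      [∀ γ : ((UnitaryGroup.cmDatum L 3 (Matrix.of fun i j : Fin 3 => if i.val + j.val + 1 = 3 then (1 : L) else 0)).Local v), MeasurableSpace (((UnitaryGroup.cmDatum L 3 (Matrix.of fun i j : Fin 3 => if i.val + j.val + 1 = 3 then (1 : L) else 0)).Local v) ⧸ Subgroup.centralizer ({γ} : Set ((UnitaryGroup.cmDatum L 3 (Matrix.of fun i j : Fin 3 => if i.val + j.val + 1 = 3 then (1 : L) else 0)).Local v)))]
      [∀ γ : ((UnitaryGroup.cmDatum L 3 (Matrix.of fun i j : Fin 3 => if i.val + j.val + 1 = 3 then (1 : L) else 0)).Local v), BorelSpace (((UnitaryGroup.cmDatum L 3 (Matrix.of fun i j : Fin 3 => if i.val + j.val + 1 = 3 then (1 : L) else 0)).Local v) ⧸ Subgroup.centralizer ({γ} : Set ((UnitaryGroup.cmDatum L 3 (Matrix.of fun i j : Fin 3 => if i.val + j.val + 1 = 3 then (1 : L) else 0)).Local v)))]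
      (S : Finset (ConjClasses ((UnitaryGroup.cmDatum L 3 (Matrix.of fun i j : Fin 3 => if i.val + j.val + 1 = 3 then (1 : L) else 0)).Local v)))
      (_hS : ∀ u ∈ S, (((Quotient.out u : ((UnitaryGroup.cmDatum L 3 (Matrix.of fun i j : Fin 3 => if i.val + j.val + 1 = 3 then (1 : L) else 0)).Local v)).val : GL (Fin 3) (UnitaryGroup.LocalRing L v)).val - 1) ^ 3 = 0)
      (mU : OrbitalMeasureFamily ((UnitaryGroup.cmDatum L 3 (Matrix.of fun i j : Fin 3 => if i.val + j.val + 1 = 3 then (1 : L) else 0)).Local v)) (_hmU : mU.IsAdmissibleOn (fun γ => (ConjClasses.mk γ) ∈ S))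
      (_hRao : ∀ u ∈ S, ∀ f : ((UnitaryGroup.cmDatum L 3 (Matrix.of fun i j : Fin 3 => if i.val + j.val + 1 = 3 then (1 : L) else 0)).Local v) → ℂ, IsLocSmooth f →
        Integrable (descConj (Quotient.out u : ((UnitaryGroup.cmDatum L 3 (Matrix.of fun i j : Fin 3 => if i.val + j.val + 1 = 3 then (1 : L) else 0)).Local v))
          (Subgroup.centralizer ({(Quotient.out u : ((UnitaryGroup.cmDatum L 3 (Matrix.of fun i j : Fin 3 => if i.val + j.val + 1 = 3 then (1 : L) else 0)).Local v))} : Set ((UnitaryGroup.cmDatum L 3 (Matrix.of fun i j : Fin 3 => if i.val + j.val + 1 = 3 then (1 : L) else 0)).Local v)))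
          (fun _ hg => Subgroup.mem_centralizer_singleton_iff.1 hg) f) (mU u)),
      ∃ e : ↥S → Fin n, Function.Injective e ∧
        (Matrix.of fun u u' : ↥S => classOrbitalIntegral mU ((gsel (e u')) L v w hw ϖ) u).det ≠ 0

/-- U4-c · `PieceRowsWild gsel j` — THE THREE POPULATION ROWS OF THE EXPLICIT PIECE `j` (ONE H-family per (place, μ); rows (1)(2)(3) = the clause shapes of
★ `localTransferAtOne_of_populations` VERBATIM; for `1_K` row (1) is law-fed by §4, rows (2)(3) are law debt; for the other pieces all three are debt until their census laws
are typed). -/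
def PieceRowsWild {n : ℕ} (gsel : Fin n → (∀ (L : Type) [Field L] [NumberField L] [IsCMField L] (v : HeightOneSpectrum (𝓞 ↥(maximalRealSubfield L))) (w : UnitaryGroup.PlacesOver L v), IsCMField.complexConj L • w.1 = w.1 → w.1.adicCompletion L → ((UnitaryGroup.cmDatum L 3 (Matrix.of fun i j : Fin 3 => if i.val + j.val + 1 = 3 then (1 : L) else 0)).Local v) → ℂ)) (j : Fin n) : Prop :=
    ∀ (L : Type) [Field L] [NumberField L] [IsCMField L]
      {v : HeightOneSpectrum (𝓞 ↥(maximalRealSubfield L))} (w : UnitaryGroup.PlacesOver L v)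
      (hw : IsCMField.complexConj L • w.1 = w.1) (_he : v.asIdeal.ramificationIdx' w.1.asIdeal ≠ 1)
      (_h2 : ¬ IsUnit (2 : 𝒪[w.1.adicCompletion L]))
      (ϖ : (w.1.adicCompletion L)) (_hϖ : Valued.v ϖ = WithZero.exp (-1 : ℤ))
      [MeasurableSpace ((UnitaryGroup.cmDatum L 3 (Matrix.of fun i j : Fin 3 => if i.val + j.val + 1 = 3 then (1 : L) else 0)).Local v)] [BorelSpace ((UnitaryGroup.cmDatum L 3 (Matrix.of fun i j : Fin 3 => if i.val + j.val + 1 = 3 then (1 : L) else 0)).Local v)]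
      [∀ γ : ((UnitaryGroup.cmDatum L 3 (Matrix.of fun i j : Fin 3 => if i.val + j.val + 1 = 3 then (1 : L) else 0)).Local v), MeasurableSpace (((UnitaryGroup.cmDatum L 3 (Matrix.of fun i j : Fin 3 => if i.val + j.val + 1 = 3 then (1 : L) else 0)).Local v) ⧸ Subgroup.centralizer ({γ} : Set ((UnitaryGroup.cmDatum L 3 (Matrix.of fun i j : Fin 3 => if i.val + j.val + 1 = 3 then (1 : L) else 0)).Local v)))]
      [∀ γ : ((UnitaryGroup.cmDatum L 3 (Matrix.of fun i j : Fin 3 => if i.val + j.val + 1 = 3 then (1 : L) else 0)).Local v), BorelSpace (((UnitaryGroup.cmDatum L 3 (Matrix.of fun i j : Fin 3 => if i.val + j.val + 1 = 3 then (1 : L) else 0)).Local v) ⧸ Subgroup.centralizer ({γ} : Set ((UnitaryGroup.cmDatum L 3 (Matrix.of fun i j : Fin 3 => if i.val + j.val + 1 = 3 then (1 : L) else 0)).Local v)))]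
      [MeasurableSpace ((UnitaryGroup.cmDatum L 2 (Matrix.of fun i j : Fin 2 => if i.val + j.val + 1 = 2 then (1 : L) else 0)).Local v × (UnitaryGroup.cmDatum L 1 (Matrix.of fun i j : Fin 1 => if i.val + j.val + 1 = 1 then (1 : L) else 0)).Local v)] [BorelSpace ((UnitaryGroup.cmDatum L 2 (Matrix.of fun i j : Fin 2 => if i.val + j.val + 1 = 2 then (1 : L) else 0)).Local v × (UnitaryGroup.cmDatum L 1 (Matrix.of fun i j : Fin 1 => if i.val + j.val + 1 = 1 then (1 : L) else 0)).Local v)]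
      [∀ a : ((UnitaryGroup.cmDatum L 2 (Matrix.of fun i j : Fin 2 => if i.val + j.val + 1 = 2 then (1 : L) else 0)).Local v × (UnitaryGroup.cmDatum L 1 (Matrix.of fun i j : Fin 1 => if i.val + j.val + 1 = 1 then (1 : L) else 0)).Local v), MeasurableSpace (((UnitaryGroup.cmDatum L 2 (Matrix.of fun i j : Fin 2 => if i.val + j.val + 1 = 2 then (1 : L) else 0)).Local v × (UnitaryGroup.cmDatum L 1 (Matrix.of fun i j : Fin 1 => if i.val + j.val + 1 = 1 then (1 : L) else 0)).Local v) ⧸ Subgroup.centralizer ({a} : Set ((UnitaryGroup.cmDatum L 2 (Matrix.of fun i j : Fin 2 => if i.val + j.val + 1 = 2 then (1 : L) else 0)).Local v × (UnitaryGroup.cmDatum L 1 (Matrix.of fun i j : Fin 1 => if i.val + j.val + 1 = 1 then (1 : L) else 0)).Local v)))]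
      [∀ a : ((UnitaryGroup.cmDatum L 2 (Matrix.of fun i j : Fin 2 => if i.val + j.val + 1 = 2 then (1 : L) else 0)).Local v × (UnitaryGroup.cmDatum L 1 (Matrix.of fun i j : Fin 1 => if i.val + j.val + 1 = 1 then (1 : L) else 0)).Local v), BorelSpace (((UnitaryGroup.cmDatum L 2 (Matrix.of fun i j : Fin 2 => if i.val + j.val + 1 = 2 then (1 : L) else 0)).Local v × (UnitaryGroup.cmDatum L 1 (Matrix.of fun i j : Fin 1 => if i.val + j.val + 1 = 1 then (1 : L) else 0)).Local v) ⧸ Subgroup.centralizer ({a} : Set ((UnitaryGroup.cmDatum L 2 (Matrix.of fun i j : Fin 2 => if i.val + j.val + 1 = 2 then (1 : L) else 0)).Local v × (UnitaryGroup.cmDatum L 1 (Matrix.of fun i j : Fin 1 => if i.val + j.val + 1 = 1 then (1 : L) else 0)).Local v)))]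
      (μ : HeckeCharacter L) (_hμu : μ.IsUnitary)
      (_hμω : ∀ x : ideleGroup ↥(maximalRealSubfield L), μ (AdeleRing.ideleBaseChange ↥(maximalRealSubfield L) L x) = quadraticHeckeCharCM L x)
      (νH : Measure ((UnitaryGroup.cmDatum L 2 (Matrix.of fun i j : Fin 2 => if i.val + j.val + 1 = 2 then (1 : L) else 0)).Local v × (UnitaryGroup.cmDatum L 1 (Matrix.of fun i j : Fin 1 => if i.val + j.val + 1 = 1 then (1 : L) else 0)).Local v)) [νH.IsHaarMeasure] [νH.IsMulRightInvariant]
      (νG₃ : Measure ((UnitaryGroup.cmDatum L 3 (Matrix.of fun i j : Fin 3 => if i.val + j.val + 1 = 3 then (1 : L) else 0)).Local v)) [νG₃.IsHaarMeasure] [νG₃.IsMulRightInvariant]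
      (mH : OrbitalMeasureFamily ((UnitaryGroup.cmDatum L 2 (Matrix.of fun i j : Fin 2 => if i.val + j.val + 1 = 2 then (1 : L) else 0)).Local v × (UnitaryGroup.cmDatum L 1 (Matrix.of fun i j : Fin 1 => if i.val + j.val + 1 = 1 then (1 : L) else 0)).Local v)) (mG₃ : OrbitalMeasureFamily ((UnitaryGroup.cmDatum L 3 (Matrix.of fun i j : Fin 3 => if i.val + j.val + 1 = 3 then (1 : L) else 0)).Local v))
      (_hmH : mH.IsCanonical (IsLocalGRegular L v) νH) (_hmG : mG₃.IsCanonical (fun γ => IsRegularElt (γ.val : GL (Fin 3) (UnitaryGroup.LocalRing L v))) νG₃),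
      ∃ (r : ℕ) (ψ : Fin r → ((UnitaryGroup.cmDatum L 2 (Matrix.of fun i j : Fin 2 => if i.val + j.val + 1 = 2 then (1 : L) else 0)).Local v × (UnitaryGroup.cmDatum L 1 (Matrix.of fun i j : Fin 1 => if i.val + j.val + 1 = 1 then (1 : L) else 0)).Local v) → ℂ) (_ : ∀ s, IsLocSmooth (ψ s)) (a : Fin r → ℂ),
        (∃ V ∈ 𝓝 (1 : ((UnitaryGroup.cmDatum L 2 (Matrix.of fun i j : Fin 2 => if i.val + j.val + 1 = 2 then (1 : L) else 0)).Local v × (UnitaryGroup.cmDatum L 1 (Matrix.of fun i j : Fin 1 => if i.val + j.val + 1 = 1 then (1 : L) else 0)).Local v)), ∀ γH ∈ V, IsLocalGRegular L v γH →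
        (∃ x : (w.1.adicCompletion L), (((((γH).1.val : GL (Fin 2) (UnitaryGroup.LocalRing L v)).val.map (Pi.evalRingHom (fun w' : UnitaryGroup.PlacesOver L v => w'.1.adicCompletion L) w))).charpoly).IsRoot x) →
        ¬ (∃ (y : ((UnitaryGroup.cmDatum L 2 (Matrix.of fun i j : Fin 2 => if i.val + j.val + 1 = 2 then (1 : L) else 0)).Local v × (UnitaryGroup.cmDatum L 1 (Matrix.of fun i j : Fin 1 => if i.val + j.val + 1 = 1 then (1 : L) else 0)).Local v)) (d' : Fin 2 → (UnitaryGroup.LocalRing L v)ˣ),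
            glDiagonal 2 (UnitaryGroup.LocalRing L v) d' = ((y * γH * y⁻¹).1.val : GL (Fin 2) (UnitaryGroup.LocalRing L v))) →
        ∑ᶠ c : ConjClasses ((UnitaryGroup.cmDatum L 3 (Matrix.of fun i j : Fin 3 => if i.val + j.val + 1 = 3 then (1 : L) else 0)).Local v), ((finExplicitCollection L (Matrix.of fun i j : Fin 3 => if i.val + j.val + 1 = 3 then (1 : L) else 0) μ (finExplicitDelta_conj_left_all L (Matrix.of fun i j : Fin 3 => if i.val + j.val + 1 = 3 then (1 : L) else 0) μ) (finExplicitDelta_conj_right_all L (Matrix.of fun i j : Fin 3 => if i.val + j.val + 1 = 3 then (1 : L) else 0) μ)) v).Δ γH (Quotient.out c) * classOrbitalIntegral mG₃ ((gsel j) L v w hw ϖ) c =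
          ∑ s, a s * stableOrbitalIntegralRel (IsLocalStablyConjH L v) mH (ψ s) γH) ∧
        (∃ V ∈ 𝓝 (1 : ((UnitaryGroup.cmDatum L 2 (Matrix.of fun i j : Fin 2 => if i.val + j.val + 1 = 2 then (1 : L) else 0)).Local v × (UnitaryGroup.cmDatum L 1 (Matrix.of fun i j : Fin 1 => if i.val + j.val + 1 = 1 then (1 : L) else 0)).Local v)), ∀ γH ∈ V, IsLocalGRegular L v γH →
        ¬ (∃ x : (w.1.adicCompletion L), (((((γH).1.val : GL (Fin 2) (UnitaryGroup.LocalRing L v)).val.map (Pi.evalRingHom (fun w' : UnitaryGroup.PlacesOver L v => w'.1.adicCompletion L) w))).charpoly).IsRoot x) →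
        ∑ᶠ c : ConjClasses ((UnitaryGroup.cmDatum L 3 (Matrix.of fun i j : Fin 3 => if i.val + j.val + 1 = 3 then (1 : L) else 0)).Local v), ((finExplicitCollection L (Matrix.of fun i j : Fin 3 => if i.val + j.val + 1 = 3 then (1 : L) else 0) μ (finExplicitDelta_conj_left_all L (Matrix.of fun i j : Fin 3 => if i.val + j.val + 1 = 3 then (1 : L) else 0) μ) (finExplicitDelta_conj_right_all L (Matrix.of fun i j : Fin 3 => if i.val + j.val + 1 = 3 then (1 : L) else 0) μ)) v).Δ γH (Quotient.out c) * classOrbitalIntegral mG₃ ((gsel j) L v w hw ϖ) c =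
          ∑ s, a s * stableOrbitalIntegralRel (IsLocalStablyConjH L v) mH (ψ s) γH) ∧
        (∃ V ∈ 𝓝 (1 : ((UnitaryGroup.cmDatum L 2 (Matrix.of fun i j : Fin 2 => if i.val + j.val + 1 = 2 then (1 : L) else 0)).Local v × (UnitaryGroup.cmDatum L 1 (Matrix.of fun i j : Fin 1 => if i.val + j.val + 1 = 1 then (1 : L) else 0)).Local v)), ∀ γH ∈ V, IsLocalGRegular L v γH →
        (∃ (y : ((UnitaryGroup.cmDatum L 2 (Matrix.of fun i j : Fin 2 => if i.val + j.val + 1 = 2 then (1 : L) else 0)).Local v × (UnitaryGroup.cmDatum L 1 (Matrix.of fun i j : Fin 1 => if i.val + j.val + 1 = 1 then (1 : L) else 0)).Local v)) (d' : Fin 2 → (UnitaryGroup.LocalRing L v)ˣ),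
            glDiagonal 2 (UnitaryGroup.LocalRing L v) d' = ((y * γH * y⁻¹).1.val : GL (Fin 2) (UnitaryGroup.LocalRing L v))) →
        ∑ᶠ c : ConjClasses ((UnitaryGroup.cmDatum L 3 (Matrix.of fun i j : Fin 3 => if i.val + j.val + 1 = 3 then (1 : L) else 0)).Local v), ((finExplicitCollection L (Matrix.of fun i j : Fin 3 => if i.val + j.val + 1 = 3 then (1 : L) else 0) μ (finExplicitDelta_conj_left_all L (Matrix.of fun i j : Fin 3 => if i.val + j.val + 1 = 3 then (1 : L) else 0) μ) (finExplicitDelta_conj_right_all L (Matrix.of fun i j : Fin 3 => if i.val + j.val + 1 = 3 then (1 : L) else 0) μ)) v).Δ γH (Quotient.out c) * classOrbitalIntegral mG₃ ((gsel j) L v w hw ϖ) c =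
          ∑ s, a s * stableOrbitalIntegralRel (IsLocalStablyConjH L v) mH (ψ s) γH)

end Summit.HodgeConjecture.HodgeConjecture.Cruxes.H413.F0P3cDyRamFourFramePieces

end
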